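import Mathlib
import Literature.Analysis.FluidPDE.HardSphereCollisionRecord
import Literature.Analysis.FluidPDE.HardSpherePreCollisionSigma
import Literature.Analysis.FluidPDE.HardSphereWindowEnumeration
import Literature.Analysis.FluidPDE.HardSphereRegularGeometry
import Literature.MathematicalPhysics.KineticTheory.HardSphereEuler
import Literature.MathematicalPhysics.KineticTheory.CollisionTubePullbackFlight
import HarnessLib

/-!
# `OneFlightGossipEngine.OneFlightLayeredChaos` — a same-start double collision inside the window wraps around the torus
(crux stmt-AtomisticToContinuum-14535, line `Sketch`, registered stub `stub_sameStart_wrap_geometry`)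

Along a hard-sphere flow on `𝕋³` at diameter `0 < ε < 1/4`, on the good set: if particle `i` has at least `n + 1 ≥ 2`
collisions in the window `(0, w]` and the flight starts (from time `0`) of `i` and of its `n`-th partner `j` before the
`n`-th collision time `t_n` of `i` COINCIDE, then some particle travels at least `1/4` during `(0, w]`
(`∃ k, 1/4 ≤ ∫⁻_{(0,w]} ‖v_k(Φ_t z)‖ dt`).

Route. (a) The window count makes the collision times of `i` of index `≤ n` genuine and increasing
(`HardSphereFlow.le_encard_collisionTimesOf_of_le_ncard`, `IsHardSphereTrajectory.nthCollisionTimeOf_enum_of_encard`,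
`HardSphereFlow.nthCollisionTimeOf_mem_window`), so the flight start `s` of `i` at `t_n` is a collision time of `i` with
`0 < t_{n-1} ≤ s < t_n` (`le_flightStart_of_mem`, `flightStart_lt`, `flightStart_mem`); being positive and equal to the
flight start of `j`, it is a collision time of `j` too. (b) Collisions are binary
(`IsHardSphereTrajectory.participates_iff`) and `i ≠ j` (`collide_partner`, `Collide.ne` at `t_n`; the torus geometry is
regular for `ε < 1/2`, `Torus.isHardSphereRegular_geometry`, `swap_mem_contactPairs_iff`), so `(i, j)` is an ordered
contact pair both at `s` — where it is OUTGOING (`IsHardSphereTrajectory.isOutgoing_of_mem_contactSet`) — and at `t_n`,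
and neither particle collides during `(s, t_n)` (`IsHardSphereTrajectory.not_participates_of_mem_Ioo_flightStart`).
(c) A DOUBLE CONTACT IN FREE FLIGHT WRAPS AROUND THE TORUS (`exists_lintegral_speed_ge_of_double_contact`): by
`orbit_posDiff_eq` the position difference at `t_n` is `proj (q₀ + (t_n − s) g)` with `q₀ = reprSym (x_i(s) − x_j(s))`,
`‖q₀‖ = ε`, `⟪q₀, g⟫ > 0`, `g = v_i(s) − v_j(s)`; the minimal image of `proj u` is `u` or has norm `≥ 1 − ‖u‖`
(`Torus.proj_eq_proj_iff_holds`, a nonzero lattice vector has norm `≥ 1`), and `‖q₀ + τ g‖ > ε` for `τ > 0`, so the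
contact `‖reprSym (proj u)‖ = ε` at `t_n` forces `(t_n − s)‖g‖ ≥ 1 − 2ε > 1/2`, whence `(t_n − s) ‖v_k(s)‖ > 1/4` for
`k = i` or `k = j`; the velocity of `k` is constant on `[s, t_n)` (`orbit_vel_eq_of_forall_not_participates`) and
`(s, t_n) ⊆ (0, w]`, so the `lintegral` of its speed over `(0, w]` is at least `(t_n − s)‖v_k(s)‖ ≥ 1/4`
(`setLIntegral_const`, `lintegral_mono_set`). No new definitions.
-/

open MeasureTheory Set
open Literature.Analysis.FluidPDE Literature.MathematicalPhysics.KineticTheory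
open Literature.Analysis.FunctionSpaces

namespace Summit.AtomisticToContinuum.HydrodynamicLimit.Theorems

noncomputable section

/-- A nonzero lattice vector of `ℤ³ ⊂ ℝ³` has Euclidean norm at least `1` (some coordinate is a nonzero integer).
[folklore] -/
theorem one_le_norm_latticeVec_of_ne_zero {k : Fin 3 → ℤ} (hk : k ≠ 0) : 1 ≤ ‖Torus.latticeVec k‖ := by
  obtain ⟨i, hi⟩ := Function.ne_iff.1 hk
  have h1 : (1 : ℝ) ≤ |(k i : ℝ)| := by
    rw [← Int.cast_abs]
    exact_mod_cast Int.one_le_abs hi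
  calc (1 : ℝ) ≤ |(k i : ℝ)| := h1
    _ = ‖Torus.latticeVec k i‖ := by rw [Torus.latticeVec_apply, Real.norm_eq_abs]
    _ ≤ ‖Torus.latticeVec k‖ := PiLp.norm_apply_le _ i

/-- **The minimal image of a lift.** For `u ∈ ℝ³`, the symmetric representative of `proj u ∈ 𝕋³` is either `u` itself
or is at least `1 − ‖u‖` long: it differs from `u` by a lattice vector, which is `0` or has norm `≥ 1`. [folklore] -/
theorem reprSym_proj_eq_self_or_le (u : V3) :
    Torus.reprSym (Torus.proj u) = u ∨ 1 - ‖u‖ ≤ ‖Torus.reprSym (Torus.proj u)‖ := by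
  have h2 : Torus.proj u = Torus.proj (Torus.reprSym (Torus.proj u)) := by rw [Torus.proj_reprSym]
  obtain ⟨k, hk⟩ := (Torus.proj_eq_proj_iff_holds u _).1 h2
  by_cases hk0 : k = 0
  · left
    rw [hk, hk0, Torus.latticeVec_zero, add_zero]
  · right
    rw [hk]
    have h1 := one_le_norm_latticeVec_of_ne_zero hk0
    have h3 : ‖Torus.latticeVec k‖ ≤ ‖u + Torus.latticeVec k‖ + ‖u‖ :=
      calc ‖Torus.latticeVec k‖ = ‖(u + Torus.latticeVec k) - u‖ := by rw [add_sub_cancel_left]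
        _ ≤ ‖u + Torus.latticeVec k‖ + ‖u‖ := norm_sub_le _ _
    linarith

/-- **Leaving an outgoing contact, the lift gets strictly longer**: `‖q‖ < ‖q + τ g‖` for `τ > 0` and `⟪q, g⟫ > 0`
(`‖q + τ g‖² = ‖q‖² + 2τ⟪q, g⟫ + τ²‖g‖²`). [folklore] -/
theorem norm_lt_norm_add_smul_of_inner_pos {q g : V3} {τ : ℝ} (hτ : 0 < τ) (hqg : 0 < inner ℝ q g) :
    ‖q‖ < ‖q + τ • g‖ := by
  have h : ‖q‖ ^ 2 < ‖q + τ • g‖ ^ 2 := by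
    rw [norm_add_sq_real, real_inner_smul_right]
    nlinarith [sq_nonneg ‖τ • g‖, mul_pos hτ hqg]
  exact lt_of_pow_lt_pow_left₀ 2 (norm_nonneg _) h

/-- **Path length of a free flight inside the window.** Along a good orbit on `𝕋³`, if particle `k` takes part in no
collision during `(s, T)` with `0 ≤ s` and `T ≤ w`, then its velocity is constant on `[s, T)` and
`(T − s) ‖v_k(s)‖ ≤ ∫⁻_{(0, w]} ‖v_k(t)‖ dt` (trivially so if `T ≤ s`, the left side being `ofReal` of a nonpositive
number). [folklore] -/
theorem ofReal_mul_norm_le_lintegral_speed {σ : ℝ} {N : ℕ}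
    {Φ : HardSphereFlow (Torus.geometry (Fin 3)) (hsDiameter σ N) (N + 1)} {z : Config (N + 1) (Fin 3) T3}
    (hz : z ∈ Φ.good) (k : Fin (N + 1)) {s T w : ℝ} (hs0 : 0 ≤ s) (hTw : T ≤ w)
    (hk : ∀ u ∈ Ioo s T, ¬ Participates (Torus.geometry (Fin 3)) (hsDiameter σ N) (Φ.flow u z) k) :
    ENNReal.ofReal ((T - s) * ‖(Φ.flow s z k).2‖) ≤ ∫⁻ t in Ioc 0 w, ENNReal.ofReal ‖(Φ.flow t z k).2‖ := by
  have hconst : ∀ t ∈ Ioo s T, (Φ.flow t z k).2 = (Φ.flow s z k).2 := fun t ht =>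
    orbit_vel_eq_of_forall_not_participates hz k hk ⟨ht.1.le, ht.2⟩
  calc ENNReal.ofReal ((T - s) * ‖(Φ.flow s z k).2‖)
      = ∫⁻ _ in Ioo s T, ENNReal.ofReal ‖(Φ.flow s z k).2‖ := by
        rw [setLIntegral_const, Real.volume_Ioo, ← ENNReal.ofReal_mul (norm_nonneg _)]
        congr 1
        ring
    _ = ∫⁻ t in Ioo s T, ENNReal.ofReal ‖(Φ.flow t z k).2‖ :=
        setLIntegral_congr_fun measurableSet_Ioo fun t ht => by rw [hconst t ht]
    _ ≤ ∫⁻ t in Ioc 0 w, ENNReal.ofReal ‖(Φ.flow t z k).2‖ :=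
        lintegral_mono_set fun t ht => ⟨hs0.trans_lt ht.1, ht.2.le.trans hTw⟩

/-- **A double contact in free flight wraps around the torus.** Along a good orbit on `𝕋³` at diameter `ε < 1/4`: if
the ordered pair `(i, j)` is in contact at times `s < T` with `0 ≤ s`, `T ≤ w`, and neither `i` nor `j` takes part in a
collision during `(s, T)`, then one of the two particles has path length at least `1/4` inside `(0, w]`. Indeed the
pair is outgoing at `s`, flies freely on `[s, T]`, and in `ℝ³` two separating spheres never touch again, so the relative
displacement `(T − s)(v_i − v_j)` reaches a nonzero lattice translate of the contact sphere:
`(T − s)‖v_i(s) − v_j(s)‖ ≥ 1 − 2ε > 1/2`. [folklore] -/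
theorem exists_lintegral_speed_ge_of_double_contact {σ : ℝ} {N : ℕ} (hε4 : hsDiameter σ N < 4⁻¹)
    {Φ : HardSphereFlow (Torus.geometry (Fin 3)) (hsDiameter σ N) (N + 1)} {z : Config (N + 1) (Fin 3) T3}
    (hz : z ∈ Φ.good) {i j : Fin (N + 1)} {s T w : ℝ} (hs0 : 0 ≤ s) (hsT : s < T) (hTw : T ≤ w)
    (hpS : (i, j) ∈ contactPairs (Torus.geometry (Fin 3)) (hsDiameter σ N) (Φ.flow s z))
    (hpT : (i, j) ∈ contactPairs (Torus.geometry (Fin 3)) (hsDiameter σ N) (Φ.flow T z))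
    (hfreeI : ∀ u ∈ Ioo s T, ¬ Participates (Torus.geometry (Fin 3)) (hsDiameter σ N) (Φ.flow u z) i)
    (hfreeJ : ∀ u ∈ Ioo s T, ¬ Participates (Torus.geometry (Fin 3)) (hsDiameter σ N) (Φ.flow u z) j) :
    ∃ k : Fin (N + 1), ENNReal.ofReal (1 / 4) ≤ ∫⁻ t in Ioc 0 w, ENNReal.ofReal ‖(Φ.flow t z k).2‖ := by
  have htraj := Φ.isTrajectory z hz
  obtain ⟨hij, hcSset⟩ := mem_contactPairs.1 hpS
  -- contact data at `s` (outgoing) and at `T`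
  have hcS : ‖Torus.reprSym ((Φ.flow s z i).1 - (Φ.flow s z j).1)‖ = hsDiameter σ N :=
    (mem_contactSet.1 hcSset).2
  have hout : 0 < inner ℝ (Torus.reprSym ((Φ.flow s z i).1 - (Φ.flow s z j).1))
      ((Φ.flow s z i).2 - (Φ.flow s z j).2) :=
    htraj.isOutgoing_of_mem_contactSet (t := s) hij hcSset
  have hcT : ‖Torus.reprSym ((Φ.flow T z i).1 - (Φ.flow T z j).1)‖ = hsDiameter σ N :=
    (mem_contactSet.1 (mem_contactPairs.1 hpT).2).2
  -- the position difference at `T` through the two free flights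
  have hdiff := orbit_posDiff_eq hz hsT.le hfreeI hfreeJ (right_mem_Icc.2 hsT.le)
  simp only [orbit_apply, relVel] at hdiff
  have hlift : (Φ.flow T z i).1 - (Φ.flow T z j).1 =
      Torus.proj (Torus.reprSym ((Φ.flow s z i).1 - (Φ.flow s z j).1) +
        (T - s) • ((Φ.flow s z i).2 - (Φ.flow s z j).2)) := by
    rw [Torus.proj_add, Torus.proj_reprSym]
    exact hdiff
  rw [hlift] at hcT
  set q₀ : V3 := Torus.reprSym ((Φ.flow s z i).1 - (Φ.flow s z j).1) with hq₀
  set g : V3 := (Φ.flow s z i).2 - (Φ.flow s z j).2 with hg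
  -- the wrap-around: `(T - s) ‖g‖ ≥ 1 - 2ε`
  have hbig : 1 - 2 * hsDiameter σ N ≤ (T - s) * ‖g‖ := by
    rcases reprSym_proj_eq_self_or_le (q₀ + (T - s) • g) with h | h
    · rw [h] at hcT
      have hlt := norm_lt_norm_add_smul_of_inner_pos (sub_pos.2 hsT) hout
      rw [hcS, hcT] at hlt
      exact absurd hlt (lt_irrefl _)
    · rw [hcT] at h
      have h4 : ‖q₀ + (T - s) • g‖ ≤ ‖q₀‖ + ‖(T - s) • g‖ := norm_add_le _ _
      rw [hcS, norm_smul, Real.norm_of_nonneg (sub_pos.2 hsT).le] at h4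
      linarith
  -- one of the two speeds is large
  have h14 : (4 : ℝ)⁻¹ = 1 / 4 := by norm_num
  rw [h14] at hε4
  have hgle : ‖g‖ ≤ ‖(Φ.flow s z i).2‖ + ‖(Φ.flow s z j).2‖ := norm_sub_le _ _
  have hmul := mul_le_mul_of_nonneg_left hgle (sub_pos.2 hsT).le
  have key : ∀ k : Fin (N + 1),
      (∀ u ∈ Ioo s T, ¬ Participates (Torus.geometry (Fin 3)) (hsDiameter σ N) (Φ.flow u z) k) →
      1 / 4 ≤ (T - s) * ‖(Φ.flow s z k).2‖ →
      ENNReal.ofReal (1 / 4) ≤ ∫⁻ t in Ioc 0 w, ENNReal.ofReal ‖(Φ.flow t z k).2‖ :=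
    fun k hk h4 => (ENNReal.ofReal_le_ofReal h4).trans (ofReal_mul_norm_le_lintegral_speed hz k hs0 hTw hk)
  by_cases hi4 : 1 / 4 ≤ (T - s) * ‖(Φ.flow s z i).2‖
  · exact ⟨i, key i hfreeI hi4⟩
  · refine ⟨j, key j hfreeJ ?_⟩
    linarith [not_le.1 hi4]

/-- **A same-start double collision inside the window wraps around the torus** (registered stub
`stub_sameStart_wrap_geometry` of crux stmt-AtomisticToContinuum-14535). On `Φ.good`, if `i` has at least
`n + 1 ≥ 2` collisions in `(0, w]` and the flight starts (from time `0`) of `i` and of its `n`-th partner `j` before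
the `n`-th collision time `t_n` of `i` COINCIDE, then some particle travels at least `1/4` during `(0, w]`:
`∃ k, 1/4 ≤ ∫⁻_{(0,w]} ‖v_k(Φ_t z)‖ dt`. The common flight start is `s = t_{n−1}(i) > 0`, a collision time of both
`i` and `j`; collisions being binary, `{i, j}` is the pair that collided at `s`, and it collides again at `t_n ≤ w`
after free flights of both — a double contact in free flight, which wraps around the torus
(`exists_lintegral_speed_ge_of_double_contact`). [folklore] -/
theorem stub_sameStart_wrap_geometry {σ : ℝ} {N : ℕ} (hε : 0 < hsDiameter σ N) (hε4 : hsDiameter σ N < 4⁻¹)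
    (Φ : HardSphereFlow (Torus.geometry (Fin 3)) (hsDiameter σ N) (N + 1)) (i : Fin (N + 1)) {n : ℕ} (hn : 1 ≤ n)
    (w : ℝ) {z : Config (N + 1) (Fin 3) T3} (hz : z ∈ Φ.good)
    (hW : n + 1 ≤ Set.ncard (collisionTimesOf (Torus.geometry (Fin 3)) (hsDiameter σ N) (fun t => Φ.flow t z) i ∩
      Set.Ioc 0 w))
    (hs : flightStart (Torus.geometry (Fin 3)) (hsDiameter σ N) (fun t => Φ.flow t z) 0 i (Φ.nthCollisionTimeOf i n z) =
      flightStart (Torus.geometry (Fin 3)) (hsDiameter σ N) (fun t => Φ.flow t z) 0 (Φ.nthPartnerOf i n z)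
        (Φ.nthCollisionTimeOf i n z)) :
    ∃ k : Fin (N + 1), ENNReal.ofReal (1 / 4) ≤ ∫⁻ t in Set.Ioc 0 w, ENNReal.ofReal ‖(Φ.flow t z k).2‖ := by
  have hε2 : hsDiameter σ N < 2⁻¹ := hε4.trans (by norm_num)
  have _ := hε -- the positivity of `ε` (part of the registered signature) is not needed
  have htraj := Φ.isTrajectory z hz
  have hG := Torus.isHardSphereRegular_geometry (d := Fin 3) hε2
  -- (a) the collision times of `i` of index `≤ n` are genuine, increasing, and `t_n` lies in the window
  have hn' := Φ.le_encard_collisionTimesOf_of_le_ncard hW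
  obtain ⟨hmem, hmono, -⟩ := htraj.nthCollisionTimeOf_enum_of_encard hn'
  have hTwin : Φ.nthCollisionTimeOf i n z ∈
      collisionTimesOf (Torus.geometry (Fin 3)) (hsDiameter σ N) (fun t => Φ.flow t z) i ∩ Ioc 0 w :=
    Φ.nthCollisionTimeOf_mem_window hz i hW
  have hT0 : 0 < Φ.nthCollisionTimeOf i n z := hTwin.2.1
  have hTw : Φ.nthCollisionTimeOf i n z ≤ w := hTwin.2.2
  have hpartT : Participates (Torus.geometry (Fin 3)) (hsDiameter σ N) (Φ.flow (Φ.nthCollisionTimeOf i n z) z) i :=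
    hTwin.1
  -- (b) the previous collision `t_{n-1}` of `i`: `0 < t_{n-1} < t_n`
  have hprev : Φ.nthCollisionTimeOf i (n - 1) z ∈
      collisionTimesOf (Torus.geometry (Fin 3)) (hsDiameter σ N) (fun t => Φ.flow t z) i ∩
        Ioc 0 (Φ.nthCollisionTimeOf i n z) :=
    hmem (n - 1) (Nat.sub_le n 1)
  have hlt : Φ.nthCollisionTimeOf i (n - 1) z < Φ.nthCollisionTimeOf i n z :=
    hmono (mem_Iic.2 (Nat.sub_le n 1)) (mem_Iic.2 le_rfl) (by omega)
  -- (c) the flight start `s` of `i` at `t_n`: `t_{n-1} ≤ s < t_n`, a collision time of `i`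
  have hfinI := htraj.finite_collisionTimesOf_inter_Ioo i 0 (Φ.nthCollisionTimeOf i n z)
  have hles : Φ.nthCollisionTimeOf i (n - 1) z ≤
      flightStart (Torus.geometry (Fin 3)) (hsDiameter σ N) (fun t => Φ.flow t z) 0 i (Φ.nthCollisionTimeOf i n z) :=
    le_flightStart_of_mem hfinI hprev.1 hprev.2.1 hlt
  have hs0 : 0 < flightStart (Torus.geometry (Fin 3)) (hsDiameter σ N) (fun t => Φ.flow t z) 0 i
      (Φ.nthCollisionTimeOf i n z) :=
    hprev.2.1.trans_le hles
  have hsT : flightStart (Torus.geometry (Fin 3)) (hsDiameter σ N) (fun t => Φ.flow t z) 0 i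
      (Φ.nthCollisionTimeOf i n z) < Φ.nthCollisionTimeOf i n z :=
    flightStart_lt hfinI hT0
  have hpartS : Participates (Torus.geometry (Fin 3)) (hsDiameter σ N)
      (Φ.flow (flightStart (Torus.geometry (Fin 3)) (hsDiameter σ N) (fun t => Φ.flow t z) 0 i
        (Φ.nthCollisionTimeOf i n z)) z) i := by
    rcases mem_insert_iff.1 (flightStart_mem hfinI) with h | h
    · exact absurd h hs0.ne'
    · exact h.1
  -- (d) the flight start of `j` is `s` too, so `j` participates at `s`
  have hpartSj : Participates (Torus.geometry (Fin 3)) (hsDiameter σ N)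
      (Φ.flow (flightStart (Torus.geometry (Fin 3)) (hsDiameter σ N) (fun t => Φ.flow t z) 0 i
        (Φ.nthCollisionTimeOf i n z)) z) (Φ.nthPartnerOf i n z) := by
    have h := htraj.flightStart_mem 0 (Φ.nthPartnerOf i n z) (Φ.nthCollisionTimeOf i n z)
    rw [← hs] at h
    rcases mem_insert_iff.1 h with h | h
    · exact absurd h hs0.ne'
    · exact h.1
  -- (e) `i ≠ j` and `(i, j)` is an ordered contact pair at `t_n`
  have hcollT : Collide (Torus.geometry (Fin 3)) (hsDiameter σ N) (Φ.flow (Φ.nthCollisionTimeOf i n z) z) i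
      (Φ.nthPartnerOf i n z) :=
    collide_partner hpartT
  have hij : i ≠ Φ.nthPartnerOf i n z := hcollT.ne
  have hpT : (i, Φ.nthPartnerOf i n z) ∈
      contactPairs (Torus.geometry (Fin 3)) (hsDiameter σ N) (Φ.flow (Φ.nthCollisionTimeOf i n z) z) := by
    rcases hcollT with h1 | h2
    · exact h1
    · exact (swap_mem_contactPairs_iff hG (p := (i, Φ.nthPartnerOf i n z))).1 h2
  -- (f) collisions are binary: at `s`, `i` collides with its partner there, and `j` participates, so it is `j`
  have hpS : (i, Φ.nthPartnerOf i n z) ∈ contactPairs (Torus.geometry (Fin 3)) (hsDiameter σ N)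
      (Φ.flow (flightStart (Torus.geometry (Fin 3)) (hsDiameter σ N) (fun t => Φ.flow t z) 0 i
        (Φ.nthCollisionTimeOf i n z)) z) := by
    have hcoll := collide_partner hpartS
    have hp' : (i, partner (Torus.geometry (Fin 3)) (hsDiameter σ N)
        (Φ.flow (flightStart (Torus.geometry (Fin 3)) (hsDiameter σ N) (fun t => Φ.flow t z) 0 i
          (Φ.nthCollisionTimeOf i n z)) z) i) ∈ contactPairs (Torus.geometry (Fin 3)) (hsDiameter σ N)
        (Φ.flow (flightStart (Torus.geometry (Fin 3)) (hsDiameter σ N) (fun t => Φ.flow t z) 0 i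
          (Φ.nthCollisionTimeOf i n z)) z) := by
      rcases hcoll with h1 | h2
      · exact h1
      · exact (swap_mem_contactPairs_iff hG (p := (i, _))).1 h2
    rcases (htraj.participates_iff
      (t := flightStart (Torus.geometry (Fin 3)) (hsDiameter σ N) (fun t => Φ.flow t z) 0 i
        (Φ.nthCollisionTimeOf i n z)) hp').1 hpartSj with h | h
    · exact absurd h.symm hij
    · rw [← h] at hp'
      exact hp'
  -- (g) neither `i` nor `j` collides during `(s, t_n)`
  have hfreeI : ∀ u ∈ Ioo (flightStart (Torus.geometry (Fin 3)) (hsDiameter σ N) (fun t => Φ.flow t z) 0 i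
      (Φ.nthCollisionTimeOf i n z)) (Φ.nthCollisionTimeOf i n z),
      ¬ Participates (Torus.geometry (Fin 3)) (hsDiameter σ N) (Φ.flow u z) i := fun u hu =>
    htraj.not_participates_of_mem_Ioo_flightStart (a := 0) (k := i) (t := Φ.nthCollisionTimeOf i n z) hu
  have hfreeJ : ∀ u ∈ Ioo (flightStart (Torus.geometry (Fin 3)) (hsDiameter σ N) (fun t => Φ.flow t z) 0 i
      (Φ.nthCollisionTimeOf i n z)) (Φ.nthCollisionTimeOf i n z),
      ¬ Participates (Torus.geometry (Fin 3)) (hsDiameter σ N) (Φ.flow u z) (Φ.nthPartnerOf i n z) := by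
    intro u hu
    refine htraj.not_participates_of_mem_Ioo_flightStart (a := 0) (k := Φ.nthPartnerOf i n z)
      (t := Φ.nthCollisionTimeOf i n z) ?_
    rw [← hs]
    exact hu
  -- (h) the double contact in free flight wraps around the torus
  exact exists_lintegral_speed_ge_of_double_contact hε4 hz hs0.le hsT hTw hpS hpT hfreeI hfreeJ

end

end Summit.AtomisticToContinuum.HydrodynamicLimit.Theorems
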